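import Mathlib.Geometry.Manifold.ContMDiff.Defs
import HarnessLib

/-!
# Patching three local formulas that agree on overlaps

General differential topology (topic `Geometry/Manifold`; everything PROVED, no definitions).
A map defined by cases from three maps `g₁`, `g₂`, `g₃` attached to open sets `U₁`, `U₂`, `U₃`,
`g q = g₁ q` on `U₁`, `= g₂ q` on `U₂ ∖ U₁`, `= g₃ q` elsewhere, agrees with `gᵢ` on ALL of `Uᵢ`
as soon as the formulas agree on the pairwise overlaps (`piecewise₃_eqOn`), and is then `Cⁿ` on
`U₁ ∪ U₂ ∪ U₃` if each `gᵢ` is `Cⁿ` on `Uᵢ` (`contMDiffOn_piecewise₃`), and injective there under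
the obvious separation hypotheses (`injOn_piecewise₃`).  This is the bookkeeping used to assemble
the tube of the genus-2 surface `Σ̄₂ ⊂ T⁴ # ℂℙ²bar` of Akhmedov–Park (Invent. Math. 181 (2010),
§3) from its neck, cap and far pieces.

## References

* J. M. Lee, *Introduction to Smooth Manifolds*, 2nd ed. (2013), Cor. 2.8 (gluing lemma for
  smooth maps on open covers). [LeeSmoothManifolds2013]
-/

noncomputable section

open scoped Manifold ContDiff Topology
open Set Function

namespace Literature.Geometry.Manifold

namespace Patching

section Eq

variable {M Z : Type*} {U₁ U₂ U₃ : Set M} {g g₁ g₂ g₃ : M → Z}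

open Classical in
/-- **The patched map agrees with each formula on its whole open set** when the formulas agree
on the pairwise overlaps. [cite: LeeSmoothManifolds2013, Cor. 2.8] -/
theorem piecewise₃_eqOn
    (hg : ∀ q, g q = if q ∈ U₁ then g₁ q else if q ∈ U₂ then g₂ q else g₃ q)
    (h12 : ∀ q ∈ U₁ ∩ U₂, g₁ q = g₂ q) (h13 : ∀ q ∈ U₁ ∩ U₃, g₁ q = g₃ q)
    (h23 : ∀ q ∈ U₂ ∩ U₃, g₂ q = g₃ q) :
    (∀ q ∈ U₁, g q = g₁ q) ∧ (∀ q ∈ U₂, g q = g₂ q) ∧ (∀ q ∈ U₃, g q = g₃ q) := by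
  refine ⟨fun q hq => by rw [hg, if_pos hq], fun q hq => ?_, fun q hq => ?_⟩
  · rw [hg]
    by_cases h1 : q ∈ U₁
    · rw [if_pos h1]; exact h12 q ⟨h1, hq⟩
    · rw [if_neg h1, if_pos hq]
  · rw [hg]
    by_cases h1 : q ∈ U₁
    · rw [if_pos h1]; exact h13 q ⟨h1, hq⟩
    · rw [if_neg h1]
      by_cases h2 : q ∈ U₂
      · rw [if_pos h2]; exact h23 q ⟨h2, hq⟩
      · rw [if_neg h2]

/-- **Injectivity of a map given by three formulas on three sets covering `S`**: it suffices that
each formula is injective on its set and that the three images of the sets are pairwise disjoint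
in the appropriate sense (`g p = g q` with `p ∈ Sᵢ`, `q ∈ Sⱼ`, `i ≠ j`, is impossible), where
`S₁, S₂, S₃ ⊆ S` are ANY sets with `g = gᵢ` on `Sᵢ` and `S ⊆ S₁ ∪ S₂ ∪ S₃`. [folklore] -/
theorem injOn_of_three_regions {S S₁ S₂ S₃ : Set M}
    (hS : S ⊆ S₁ ∪ S₂ ∪ S₃)
    (h1 : ∀ q ∈ S₁, g q = g₁ q) (h2 : ∀ q ∈ S₂, g q = g₂ q) (h3 : ∀ q ∈ S₃, g q = g₃ q)
    (hi1 : InjOn g₁ S₁) (hi2 : InjOn g₂ S₂) (hi3 : InjOn g₃ S₃)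
    (hd12 : ∀ p ∈ S₁, ∀ q ∈ S₂, g₁ p ≠ g₂ q) (hd13 : ∀ p ∈ S₁, ∀ q ∈ S₃, g₁ p ≠ g₃ q)
    (hd23 : ∀ p ∈ S₂, ∀ q ∈ S₃, g₂ p ≠ g₃ q) : InjOn g S := by
  intro p hp q hq h
  rcases hS hp with (hp1 | hp2) | hp3 <;> rcases hS hq with (hq1 | hq2) | hq3
  · rw [h1 p hp1, h1 q hq1] at h; exact hi1 hp1 hq1 h
  · rw [h1 p hp1, h2 q hq2] at h; exact absurd h (hd12 p hp1 q hq2)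
  · rw [h1 p hp1, h3 q hq3] at h; exact absurd h (hd13 p hp1 q hq3)
  · rw [h2 p hp2, h1 q hq1] at h; exact absurd h.symm (hd12 q hq1 p hp2)
  · rw [h2 p hp2, h2 q hq2] at h; exact hi2 hp2 hq2 h
  · rw [h2 p hp2, h3 q hq3] at h; exact absurd h (hd23 p hp2 q hq3)
  · rw [h3 p hp3, h1 q hq1] at h; exact absurd h.symm (hd13 q hq1 p hp3)
  · rw [h3 p hp3, h2 q hq2] at h; exact absurd h.symm (hd23 q hq2 p hp3)
  · rw [h3 p hp3, h3 q hq3] at h; exact hi3 hp3 hq3 h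

/-- **Images of open sets under a map given by three open formulas are open**: if `g = gᵢ` on the
open `Uᵢ` and each `gᵢ` maps open subsets of `Uᵢ` to open sets, then `g` maps open subsets of
`U₁ ∪ U₂ ∪ U₃` to open sets. [folklore] -/
theorem isOpen_image_of_three [TopologicalSpace M] [TopologicalSpace Z]
    (hU₁ : IsOpen U₁) (hU₂ : IsOpen U₂) (hU₃ : IsOpen U₃)
    (h1 : ∀ q ∈ U₁, g q = g₁ q) (h2 : ∀ q ∈ U₂, g q = g₂ q) (h3 : ∀ q ∈ U₃, g q = g₃ q)
    (ho1 : ∀ O, IsOpen O → O ⊆ U₁ → IsOpen (g₁ '' O))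
    (ho2 : ∀ O, IsOpen O → O ⊆ U₂ → IsOpen (g₂ '' O))
    (ho3 : ∀ O, IsOpen O → O ⊆ U₃ → IsOpen (g₃ '' O))
    {O : Set M} (hO : IsOpen O) (hOU : O ⊆ U₁ ∪ U₂ ∪ U₃) : IsOpen (g '' O) := by
  have heq : g '' O = g₁ '' (O ∩ U₁) ∪ g₂ '' (O ∩ U₂) ∪ g₃ '' (O ∩ U₃) := by
    apply Subset.antisymm
    · rintro _ ⟨q, hq, rfl⟩
      rcases hOU hq with (h | h) | h
      · exact Or.inl (Or.inl ⟨q, ⟨hq, h⟩, (h1 q h).symm⟩)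
      · exact Or.inl (Or.inr ⟨q, ⟨hq, h⟩, (h2 q h).symm⟩)
      · exact Or.inr ⟨q, ⟨hq, h⟩, (h3 q h).symm⟩
    · rintro z ((⟨q, ⟨hq, h⟩, rfl⟩ | ⟨q, ⟨hq, h⟩, rfl⟩) | ⟨q, ⟨hq, h⟩, rfl⟩)
      · exact ⟨q, hq, h1 q h⟩
      · exact ⟨q, hq, h2 q h⟩
      · exact ⟨q, hq, h3 q h⟩
  rw [heq]
  exact ((ho1 _ (hO.inter hU₁) inter_subset_right).union
    (ho2 _ (hO.inter hU₂) inter_subset_right)).union (ho3 _ (hO.inter hU₃) inter_subset_right)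

end Eq

section Smooth

variable {E : Type*} [NormedAddCommGroup E] [NormedSpace ℝ E] {H : Type*} [TopologicalSpace H]
  {I : ModelWithCorners ℝ E H} {M : Type*} [TopologicalSpace M] [ChartedSpace H M]
  {E' : Type*} [NormedAddCommGroup E'] [NormedSpace ℝ E'] {H' : Type*} [TopologicalSpace H']
  {I' : ModelWithCorners ℝ E' H'} {Z : Type*} [TopologicalSpace Z] [ChartedSpace H' Z]
  {n : WithTop ℕ∞}
  {U₁ U₂ U₃ : Set M} {g g₁ g₂ g₃ : M → Z}

/-- **Gluing lemma for smooth maps**: a map which on each open `Uᵢ` agrees with a map that is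
`Cⁿ` on `Uᵢ` is `Cⁿ` on any `S ⊆ U₁ ∪ U₂ ∪ U₃`. [cite: LeeSmoothManifolds2013, Cor. 2.8] -/
theorem contMDiffOn_of_three {S : Set M} (hS : S ⊆ U₁ ∪ U₂ ∪ U₃)
    (hU₁ : IsOpen U₁) (hU₂ : IsOpen U₂) (hU₃ : IsOpen U₃)
    (h1 : ∀ q ∈ U₁, g q = g₁ q) (h2 : ∀ q ∈ U₂, g q = g₂ q) (h3 : ∀ q ∈ U₃, g q = g₃ q)
    (hg₁ : ContMDiffOn I I' n g₁ U₁) (hg₂ : ContMDiffOn I I' n g₂ U₂)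
    (hg₃ : ContMDiffOn I I' n g₃ U₃) : ContMDiffOn I I' n g S := by
  intro q hq
  apply ContMDiffAt.contMDiffWithinAt
  rcases hS hq with (h | h) | h
  · exact ((hg₁.congr h1).contMDiffAt (hU₁.mem_nhds h))
  · exact ((hg₂.congr h2).contMDiffAt (hU₂.mem_nhds h))
  · exact ((hg₃.congr h3).contMDiffAt (hU₃.mem_nhds h))

/-- **Patching local left inverses**: if `g` is injective on `S`, and `S` is covered by sets `Uᵢ`
on which `g = gᵢ` has a left inverse `rᵢ` that is `Cⁿ` on `gᵢ '' Uᵢ`, each `g '' Uᵢ` being open,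
then any left inverse `r` of `g` on `S` (`r (g q) = q` for `q ∈ S`) is `Cⁿ` on `g '' S`.
[cite: LeeSmoothManifolds2013, Prop. 5.2] -/
theorem contMDiffOn_leftInverse_of_three {S : Set M} (hS : S ⊆ U₁ ∪ U₂ ∪ U₃)
    (hU₁S : U₁ ⊆ S) (hU₂S : U₂ ⊆ S) (hU₃S : U₃ ⊆ S)
    (h1 : ∀ q ∈ U₁, g q = g₁ q) (h2 : ∀ q ∈ U₂, g q = g₂ q) (h3 : ∀ q ∈ U₃, g q = g₃ q)
    (ho1 : IsOpen (g '' U₁)) (ho2 : IsOpen (g '' U₂)) (ho3 : IsOpen (g '' U₃))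
    {r₁ r₂ r₃ r : Z → M}
    (hr₁ : ContMDiffOn I' I n r₁ (g₁ '' U₁)) (hr₁l : ∀ q ∈ U₁, r₁ (g₁ q) = q)
    (hr₂ : ContMDiffOn I' I n r₂ (g₂ '' U₂)) (hr₂l : ∀ q ∈ U₂, r₂ (g₂ q) = q)
    (hr₃ : ContMDiffOn I' I n r₃ (g₃ '' U₃)) (hr₃l : ∀ q ∈ U₃, r₃ (g₃ q) = q)
    (hr : ∀ q ∈ S, r (g q) = q) : ContMDiffOn I' I n r (g '' S) := by
  rintro _ ⟨q, hq, rfl⟩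
  apply ContMDiffAt.contMDiffWithinAt
  -- on `g '' Uᵢ ∋ g q` (open), `r` agrees with `rᵢ`
  have key : ∀ {U : Set M} {gi : M → Z} {ri : Z → M}, U ⊆ S → (∀ q ∈ U, g q = gi q) →
      IsOpen (g '' U) → ContMDiffOn I' I n ri (gi '' U) → (∀ q ∈ U, ri (gi q) = q) → q ∈ U →
      ContMDiffAt I' I n r (g q) := by
    intro U gi ri hUS hgi hoi hri hril hqU
    have himg : g '' U = gi '' U := by
      apply Subset.antisymm
      · rintro _ ⟨p, hp, rfl⟩; exact ⟨p, hp, (hgi p hp).symm⟩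
      · rintro _ ⟨p, hp, rfl⟩; exact ⟨p, hp, hgi p hp⟩
    have hriAt : ContMDiffAt I' I n ri (g q) :=
      (himg ▸ hri).contMDiffAt (hoi.mem_nhds ⟨q, hqU, rfl⟩)
    refine hriAt.congr_of_eventuallyEq ?_
    filter_upwards [hoi.mem_nhds ⟨q, hqU, rfl⟩] with z hz
    obtain ⟨p, hp, rfl⟩ := hz
    rw [hr p (hUS hp), hgi p hp, hril p hp]
  rcases hS hq with (h | h) | h
  · exact key hU₁S h1 ho1 hr₁ hr₁l h
  · exact key hU₂S h2 ho2 hr₂ hr₂l h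
  · exact key hU₃S h3 ho3 hr₃ hr₃l h

end Smooth

end Patching

end Literature.Geometry.Manifold
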